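import Mathlib
import Literature.Analysis.FluidPDE.TypeIAncientMild
import Literature.Analysis.FluidPDE.LocalTypeI
import Literature.Analysis.FluidPDE.ClassicalSolution

/-!
# Sketch — crux-ideate round 1, ideator 1, crux `FarPastLedger` (stmt-NavierStokesRegularity-14060)

First lemmas of the two idea cards, stated over tree declarations (no proofs of analysis; the
only `theorem` is a pure-logic assembly check).

* Card `type-i-clock-morrey-upgrade`: `SubquadraticLedger`, `ClockCubicBound` (L1),
  `BasePressureBound` (L2), `SubquadraticSuffices` (L1+L2+tree Seregin lemma), `CoarseLedger` (L0),
  and the assembly `farPastLedgerSig_of_cards`.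
* Card `caloric-scale-space-ledger`: `gaussEnergy`, `supGaussEnergy`, `CaloricLedgerIneq`,
  `volterraK`, `VolterraThreeStep`, `VolterraTwoStepSubquadratic`.
-/

noncomputable section

namespace Summit.NavierStokesRegularity.NavierStokesRegularity.Cruxes.FarPastLedger.Ideator1

open MeasureTheory Set Metric Real
open Literature.Analysis.FluidPDE

local notation "ℝ³" => EuclideanSpace ℝ (Fin 3)

/-! ## The crux, verbatim (mirror of `Theses.SymmetryModuliCount.FarPastLedger`) -/

/-- VERBATIM body of the route decl `FarPastLedger` (as in `Disproof.lean §1`). -/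
def FarPastLedgerSig : Prop :=
  ∀ C : ℝ, ∃ K : ℝ, ∀ (u : ℝ → ℝ³ → ℝ³), IsTypeIAncientMild C u → ∀ t < 0, ∀ (x₀ : ℝ³) (R : ℝ), 0 < R →
    ∫ x in ball x₀ R, ‖u t x‖ ^ 2 ≤ K * R

/-! ## Card 1 — `type-i-clock-morrey-upgrade` -/

/-- The SCALE-INVARIANT intermediate ledger with exponent `a` and constant `A`:
`∫_{B_R(x₀)} |u(t)|² ≤ A R^a (−t)^{(1−a)/2}`, i.e. `e(m) ≤ A m^a` for the scale function
`e(m) = (−t)^{-1/2} ∫_{B_{m√(−t)}} |u(t)|²`.  Invariant under `u ↦ λu(λ²t, λx)`; at `a = 1` it is the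
crux, at `a = 3` it is the Type-I bound (`A = (4π/3)C²`).  NOT the `t`-uniform family
`FarPastLedgerExp a` of `Disproof.lean §6` (which is X in costume for `a ≠ 1`). -/
def SubquadraticLedger (a A : ℝ) (u : ℝ → ℝ³ → ℝ³) : Prop :=
  ∀ t < 0, ∀ (x₀ : ℝ³) (R : ℝ), 0 < R →
    ∫ x in ball x₀ R, ‖u t x‖ ^ 2 ≤ A * R ^ a * (-t) ^ ((1 - a) / 2)

/-- **L1 — THE CLOCK LEMMA** (first lemma of the card; size S).  For `u ∈ A_C` obeying a
sub-quadratic ledger (`a < 2`), the CKN/Albritton–Barker cubic functional is bounded on EVERY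
backward cylinder with top `t₀ ≤ 0` (lid included), uniformly:
`C(Q_r(t₀,x₀)) = r⁻² ∫∫_{Q_r} |u|³ ≤ 2CA/(2−a)`.
Proof: `|u|³ ≤ (C/√(−τ))|u|²` and `∫_{B_r}|u(τ)|² ≤ A r^a (−τ)^{(1−a)/2}`, so the time integrand is
`CA r^a (−τ)^{−a/2}`, integrable at the lid iff `a < 2`; worst case `t₀ = 0`:
`CA r^a ∫₀^{r²} s^{−a/2} ds = (2CA/(2−a)) r²`. -/
def ClockCubicBound : Prop :=
  ∀ (C a A : ℝ), a < 2 → ∀ (u : ℝ → ℝ³ → ℝ³), IsTypeIAncientMild C u → SubquadraticLedger a A u →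
    ∀ (t₀ : ℝ) (x₀ : ℝ³) (r : ℝ), t₀ ≤ 0 → 0 < r →
      cknC r (t₀, x₀) u ≤ ENNReal.ofReal (2 * C * A / (2 - a))

/-- The same bound written with real iterated integrals (the form a prover may prefer). -/
def ClockCubicBoundReal : Prop :=
  ∀ (C a A : ℝ), a < 2 → ∀ (u : ℝ → ℝ³ → ℝ³), IsTypeIAncientMild C u → SubquadraticLedger a A u →
    ∀ (t₀ : ℝ) (x₀ : ℝ³) (r : ℝ), t₀ ≤ 0 → 0 < r →
      ∫ τ in Ioo (t₀ - r ^ 2) t₀, ∫ x in ball x₀ r, ‖u τ x‖ ^ 3 ≤ 2 * C * A / (2 - a) * r ^ 2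

/-- The KNSS NEAR/FAR pressure structure (verbatim the alias `NearFarPressure` of the existing line
`Cruxes/ForcedSymmetry/Lines/far-past-energy-ledger.lean`, so that the two lines share stub S1). -/
def NearFarPressure (c₀ C : ℝ) (u : ℝ → ℝ³ → ℝ³) (p : ℝ → ℝ³ → ℝ) : Prop :=
  ∀ t < 0, ∀ (x₀ : ℝ³) (R : ℝ), 0 < R → ∃ (c : ℝ) (p₁ p₂ : ℝ³ → ℝ), (∀ x ∈ Metric.ball x₀ (2 *
  R), p t x = c + p₁ x + p₂ x) ∧ MeasureTheory.MemLp p₁ 2 MeasureTheory.volume ∧ (∫ x, p₁ x ^ 2) ≤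
  c₀ * (C ^ 2 / (-t)) * ∫ x in Metric.ball x₀ (4 * R), ‖u t x‖ ^ 2 ∧ (∀ x ∈ Metric.ball x₀ (2 *
  R), DifferentiableAt ℝ p₂ x ∧ ‖fderiv ℝ p₂ x‖ ≤ c₀ * ∫ y in (Metric.ball x₀ (4 * R))ᶜ, ‖u t y‖ ^
  2 / ‖y - x₀‖ ^ 4)

/-- **L2 — BASE-SCALE PRESSURE BOUND** (size M; the ONLY place the scale-sensitive near/far
structure is used, once, non-iterated).  Under a sub-quadratic ledger the MEAN-FREE pressure
functional `D_osc(Q_r(t₀,x₀)) = r⁻² ∫∫_{Q_r} |p − [p]_{B_r}|^{3/2}` is bounded on every backward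
cylinder with top `t₀ ≤ 0`: near part `‖p₁(τ)‖_{3/2}^{3/2} ≲ ‖u‖_∞ ‖u‖²_{L²(B_{4r})}` is the clock
integrand again (needs `a < 2`); far part `osc_{B_r} p₂(τ) ≲ r Σ_k (2^k r)^{-4} ∫_{B_{2^{k+1}r}}|u(τ)|²
≲ A r^{a−3} (−τ)^{(1−a)/2}` (dyadic sum convergent for `a < 4`), whose `3/2`-power is integrable at the
lid iff `a < 7/3`. -/
def BasePressureBound : Prop :=
  ∀ (C a A c₀ : ℝ), a < 2 → ∃ D₀ : ℝ, ∀ (u : ℝ → ℝ³ → ℝ³) (p : ℝ → ℝ³ → ℝ),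
    IsTypeIAncientMild C u → SubquadraticLedger a A u →
    IsClassicalNSSolutionOn (Set.Iio 0) 1 0 u p → NearFarPressure c₀ C u p →
    ∀ (t₀ : ℝ) (x₀ : ℝ³) (r : ℝ), t₀ ≤ 0 → 0 < r → cknDOsc r (t₀, x₀) p ≤ ENNReal.ofReal D₀

/-- **THE UPGRADE** (L1 + L2 + the PROVED tree theorem
`Literature.Analysis.FluidPDE.Seregin2020.scaledEnergies_bounded_of_cknC_le_unif` = Seregin 2006
Lemma 2.1(b) / Albritton–Barker 2019 Lemma 2.6 with uniform constants): any sub-quadratic ledger on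
`A_C` upgrades to the LERAY RATE.  `K` depends on `(C, a, A, c₀)` only. -/
def SubquadraticSuffices : Prop :=
  ∀ (C a A c₀ : ℝ), a < 2 → ∃ K : ℝ, ∀ (u : ℝ → ℝ³ → ℝ³) (p : ℝ → ℝ³ → ℝ),
    IsTypeIAncientMild C u → SubquadraticLedger a A u →
    IsClassicalNSSolutionOn (Set.Iio 0) 1 0 u p → NearFarPressure c₀ C u p →
    ∀ t < 0, ∀ (x₀ : ℝ³) (R : ℝ), 0 < R → ∫ x in ball x₀ R, ‖u t x‖ ^ 2 ≤ K * R

/-- **L0 — COARSE LEDGER** (two non-borderline bootstrap steps, exponent `3 → 2 → 3/2`; size M):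
either the existing ball ledger stopped one step early, or the caloric ledger of card 2 with the
BMO pressure pairing. -/
def CoarseLedger : Prop :=
  ∀ (C c₀ : ℝ), ∃ A : ℝ, ∀ (u : ℝ → ℝ³ → ℝ³) (p : ℝ → ℝ³ → ℝ),
    IsTypeIAncientMild C u → IsClassicalNSSolutionOn (Set.Iio 0) 1 0 u p → NearFarPressure c₀ C u p →
    SubquadraticLedger (3 / 2) A u

/-- The KNSS pressure input (stub S1 of the existing line, shared): every `u ∈ A_C` carries a
classical pressure with the near/far structure, one absolute `c₀`. -/
def KNSSPressure : Prop :=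
  ∃ c₀ : ℝ, ∀ (C : ℝ) (u : ℝ → ℝ³ → ℝ³), IsTypeIAncientMild C u → ∃ p : ℝ → ℝ³ → ℝ,
    IsClassicalNSSolutionOn (Set.Iio 0) 1 0 u p ∧ NearFarPressure c₀ C u p

/-- ASSEMBLY CHECK (pure logic): the card's three pieces give the crux verbatim. -/
theorem farPastLedgerSig_of_cards (hP : KNSSPressure) (h0 : CoarseLedger)
    (hU : SubquadraticSuffices) : FarPastLedgerSig := by
  intro C
  obtain ⟨c₀, hc₀⟩ := hP
  obtain ⟨A, hA⟩ := h0 C c₀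
  obtain ⟨K, hK⟩ := hU C (3 / 2) A c₀ (by norm_num)
  refine ⟨K, fun u hu t ht x₀ R hR => ?_⟩
  obtain ⟨p, hcl, hnf⟩ := hc₀ C u hu
  exact hK u p hu (hA u p hu hcl hnf) hcl hnf t ht x₀ R hR

/-! ## Card 2 — `caloric-scale-space-ledger` -/

/-- Gaussian (heat-kernel) energy density of the slice `u(t)` at centre `x₀` and scale² `σ`:
`Θ(t,x₀,σ) = ½ ∫ G_σ(x − x₀) |u(t,x)|² dx`, `G_σ(z) = (4πσ)^{-3/2} e^{−|z|²/4σ}`.  As a function of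
`(x₀, σ)` it solves the heat equation `∂_σ Θ = Δ_{x₀} Θ` (semigroup law `G_σ * G_σ' = G_{σ+σ'}`). -/
def gaussEnergy (u : ℝ → ℝ³ → ℝ³) (t : ℝ) (x₀ : ℝ³) (σ : ℝ) : ℝ :=
  ∫ x, (4 * π * σ) ^ (-(3 / 2 : ℝ)) * exp (-‖x - x₀‖ ^ 2 / (4 * σ)) * (‖u t x‖ ^ 2 / 2)

/-- `Θ*(t,σ) = sup_{x₀} Θ(t,x₀,σ)` — NON-INCREASING in `σ` by the semigroup law (an average of
translates cannot exceed the sup), the monotone quantity replacing ball coverings/re-centrings.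
Type I: `Θ* ≤ C²/(2(−t))`; Leray rate ⇔ `Θ*(t,σ) ≲ K σ^{-1}` for `σ ≥ −t`. -/
def supGaussEnergy (u : ℝ → ℝ³ → ℝ³) (t σ : ℝ) : ℝ :=
  ⨆ x₀ : ℝ³, gaussEnergy u t x₀ σ

/-- Gaussian mean oscillation of the pressure at scale² `σ` (the BMO-type input, squared):
`∫ G_σ(x − x₀) |p(t,x) − (G_σ * p(t))(x₀)|² dx`. -/
def gaussOsc (p : ℝ → ℝ³ → ℝ) (t : ℝ) (x₀ : ℝ³) (σ : ℝ) : ℝ :=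
  ∫ x, (4 * π * σ) ^ (-(3 / 2 : ℝ)) * exp (-‖x - x₀‖ ^ 2 / (4 * σ)) *
    (p t x - ∫ y, (4 * π * σ) ^ (-(3 / 2 : ℝ)) * exp (-‖y - x₀‖ ^ 2 / (4 * σ)) * p t y) ^ 2

/-- **THE CALORIC LEDGER INEQUALITY** (first lemma of card 2; size M).  Exact identity behind it:
along the backward-caloric weight `Ψ(τ,x) = G_{σ+t−τ}(x−x₀)` (`∂_τΨ + ΔΨ = 0`),
`d/dτ ½∫Ψ|u|² = −∫Ψ|∇u|² + ∫(½|u|² + p − c) u·∇Ψ`, and `½∫Ψ|u(τ)|² ≤ C²/(2(−τ)) → 0` at `τ = −∞`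
(Type I), so `Θ(t,x₀,σ) + dissipation = ∫_{−∞}^t flux` — NO entry time, NO `|u|²ΔΨ` term.  With
`|∇G_s| ≤ κ₀ s^{-1/2} G_{2s}`, one Type-I factor on the cubic flux and the Gaussian John–Nirenberg
pairing on the pressure flux (`gaussOsc ≤ (C₂/(−τ))²`, the KNSS `L^∞`–BMO bound), the sup-density
obeys ONE scalar Volterra inequality across scale-space: -/
def CaloricLedgerIneq : Prop :=
  ∃ κ : ℝ, ∀ (C C₂ : ℝ) (u : ℝ → ℝ³ → ℝ³) (p : ℝ → ℝ³ → ℝ),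
    IsTypeIAncientMild C u → IsClassicalNSSolutionOn (Set.Iio 0) 1 0 u p →
    (∀ t < 0, ∀ (x₀ : ℝ³) (σ : ℝ), 0 < σ → gaussOsc p t x₀ σ ≤ (C₂ / (-t)) ^ 2) →
    ∀ t < 0, ∀ σ : ℝ, 0 < σ →
      supGaussEnergy u t σ ≤ κ * ∫ θ in Ioi (0 : ℝ), (σ + θ) ^ (-(1 / 2 : ℝ)) *
        ((C / sqrt (-t + θ)) * supGaussEnergy u (t - θ) (2 * (σ + θ)) +
         (C₂ / (-t + θ)) * sqrt (supGaussEnergy u (t - θ) (2 * (σ + θ))))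

/-- The scalar Volterra kernel of the caloric ledger in the Type-I normalisation `−t = 1`
(scale shrink factor `c ∈ (0,1]`): `(K g)(s) = ∫₀^∞ (s+θ)^{-1/2} (1+θ)^{-3/2} g(c(s+θ)/(1+θ)) dθ`. -/
def volterraK (c : ℝ) (g : ℝ → ℝ) (s : ℝ) : ℝ :=
  ∫ θ in Ioi (0 : ℝ), (s + θ) ^ (-(1 / 2 : ℝ)) * (1 + θ) ^ (-(3 / 2 : ℝ)) * g (c * (s + θ) / (1 + θ))

/-- **REAL-VARIABLE LEMMA (cubic ladder)**: three Picard steps from the constant Type-I bound reach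
the Leray rate: `K(K(K 1))(s) ≤ k/s` for `s ≥ 1` (closed forms: `K1 ≍ 2s^{-1/2}`,
`K²1 = 2c^{-1/2} log(s)/(s−1)`-type, `K³1 = O(1/s)` — the log is absorbed because
`∫₀^s θ^{-1/2} log(s/(1+θ)) dθ = O(√s)`).  Checked numerically: kit job j011331. -/
def VolterraThreeStep : Prop :=
  ∀ c : ℝ, 0 < c → c ≤ 1 → ∃ k : ℝ, ∀ s : ℝ, 1 ≤ s →
    volterraK c (volterraK c (volterraK c fun _ => (1 : ℝ))) s ≤ k / s

/-- **REAL-VARIABLE LEMMA (two steps, with the sublinear BMO-pressure term)**: the map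
`T g = K g + K (√g)` takes the constant to `O(s^{-1/2})` and then to `O(s^{-3/4})`, i.e. exponent
`a = 3/2 < 2` in ball language — the input of card 1 (`CoarseLedger`).  (Its further iterates saturate
at `log s / s`: with an `L^∞`–BMO pressure bound alone the Leray rate is NOT reached — kit j011331 —
which is why the last step is handed to the clock/Morrey upgrade.) -/
def VolterraTwoStepSubquadratic : Prop :=
  ∀ c : ℝ, 0 < c → c ≤ 1 → ∃ k : ℝ, ∀ s : ℝ, 1 ≤ s →
    let T : (ℝ → ℝ) → ℝ → ℝ := fun g => fun s' => volterraK c g s' + volterraK c (fun r => sqrt (g r)) s'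
    T (T fun _ => (1 : ℝ)) s ≤ k * s ^ (-(3 / 4 : ℝ))

end Summit.NavierStokesRegularity.NavierStokesRegularity.Cruxes.FarPastLedger.Ideator1
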